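import Summits.Parity.GeneralizedHardyLittlewood.Theorems.PrimeLevelFamEdgeMomentsBeyondDiagonalDiagRemThreeThreeColumns
import HarnessLib

/-!
# Route `PrimeLevelFamEdge`, crux K_A `MomentsBeyondDiagonal` (stmt-Parity-20007), line «petersson_layers» v4, stub `stub_diag`:
# **the `105P₂⁴ − 420P₂²P₄ + 448P₂P₆ + 140P₄² − 272P₈`-decorated column of the order-`(4,4)` remainder weight — trivial bounds**
# (brick of (R₄₄); the order-`(4,4)` twin of `…DiagRemThreeThreeColumns` (p831? `decorSix`) and `…DiagRemTwoTwoColumns` (`decorFour`))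

The Hecke-summed weight of order `(4,4)` (`…DiagDecorOrderFourFourHecke.selbergOrderFourFour_hecke_eq`, p839105; hypothesis `hR` of
`…DiagOrderFourFourOfR44.orderFourFour_target_of_remainder`, p839686) has, against `r₀₀`, the octic decoration
`(105S₂⁴ − 420S₂²S₄ + 448S₂S₆ + 140S₄² − 272S₈)/256 = 𝔼D⁸/256`, `S_m = P_m(k₁) + P_m(k₂)`, `P_m(k) = Σ_{p∣k} logᵐp`; its one-sided part
is the NEW column `D₈(k) = 105P₂(k)⁴ − 420P₂(k)²P₄(k) + 448P₂(k)P₆(k) + 140P₄(k)² − 272P₈(k)` (envelope `Ψ₈` of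
`…DiagRemFourFourMonomials.abs_monomial_weight_le₄₄`; the mixed parts `28·P₂⊗D₆`, `70·D₄⊗D₄` are both-sided). As for the quartic and
sextic columns, a column only needs bounded partial sums and absolute first moments — the trivial bound `|D₈(k)| ≤ 1385 log⁸k`
(`1385 = 105 + 420 + 448 + 140 + 272`):

* `abs_decorEight_le` — `|D₈(k)| ≤ 1385 log⁸ k`;
* `sum_tau_div_decorEight_ellp_pow_le` — `Σ_{k≤Y} (τ(k)/k)|D₈(k)|ℓ⁺(k)^m ≤ 1385·log^mY·(1+log Y)¹⁰`;
* `abs_sum_copTauW_decorEight_le` — **`|Σ_{k≤e} a_n(k)D₈(k)| ≤ 1385(1+log Y)¹⁰`** (`e ≤ ⌊Y⌋`);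
* `sum_abs_copTauW_decorEight_ellp_pow_le` — **`Σ_{k≤Y} |a_n(k)D₈(k)|ℓ⁺(k)^m ≤ 1385·log^mY·(1+log Y)¹⁰`.**

Def-free; theorems only. Helper `--supports stmt-Parity-20007`; closes nothing; K_A, K_B and the Parity summit are NOT proved;
nothing about Landau–Siegel zeros.

## References
* E. Kowalski, P. Michel, J. VanderKam, J. reine angew. Math. 526 (2000), (22)–(28) pp. 12–15 and Prop. 5.1 p. 18.
  [cite: KowalskiMichelVanderKam2000, Prop. 5.1 — derivation (decorated remainder monomials of order (4,4))]
-/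

noncomputable section

open Real Finset

namespace Summit.Parity.GeneralizedHardyLittlewood.Theorems.MomentsBeyondDiagonal.DiagCorner

open Literature.Barriers.Parity (Icc_one_eq_Ioc_zero)
open Summit.Parity.GeneralizedHardyLittlewood.Theorems.BeyondDiagonalBeatsQuarter.KernelFormXSq
  (copTauW copTauW_apply divWeight divWeight_nonneg abs_W_le)
open Summit.Parity.GeneralizedHardyLittlewood.Theorems.BeyondDiagonalBeatsQuarter.Corner

/-! ### The `105P₂⁴ − 420P₂²P₄ + 448P₂P₆ + 140P₄² − 272P₈`-decorated column -/

/-- `|D₈(k)| ≤ 1385 log⁸k` (`k ≥ 1`). [folklore] -/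
theorem abs_decorEight_le {k : ℕ} (hk : k ≠ 0) :
    |105 * (∑ p ∈ k.primeFactors, Real.log p ^ 2) ^ 4 - 420 * (∑ p ∈ k.primeFactors, Real.log p ^ 2) ^ 2 * (∑ p ∈ k.primeFactors, Real.log p ^ 4) +
        448 * (∑ p ∈ k.primeFactors, Real.log p ^ 2) * (∑ p ∈ k.primeFactors, Real.log p ^ 6) + 140 * (∑ p ∈ k.primeFactors, Real.log p ^ 4) ^ 2 -
        272 * ∑ p ∈ k.primeFactors, Real.log p ^ 8| ≤ 1385 * Real.log k ^ 8 := by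
  have h2 := sum_primeFactors_log_pow_le hk (show 1 ≤ 2 by norm_num)
  have h4 := sum_primeFactors_log_pow_le hk (show 1 ≤ 4 by norm_num)
  have h6 := sum_primeFactors_log_pow_le hk (show 1 ≤ 6 by norm_num)
  have h8 := sum_primeFactors_log_pow_le hk (show 1 ≤ 8 by norm_num)
  have h20 : 0 ≤ ∑ p ∈ k.primeFactors, Real.log p ^ 2 := Finset.sum_nonneg fun p _ ↦ sq_nonneg _
  have h40 : 0 ≤ ∑ p ∈ k.primeFactors, Real.log p ^ 4 := Finset.sum_nonneg fun p _ ↦ by positivity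
  have h60 : 0 ≤ ∑ p ∈ k.primeFactors, Real.log p ^ 6 := Finset.sum_nonneg fun p _ ↦ by positivity
  have h80 : 0 ≤ ∑ p ∈ k.primeFactors, Real.log p ^ 8 := Finset.sum_nonneg fun p _ ↦ by positivity
  have hlogk : 0 ≤ Real.log k := Real.log_nonneg (by exact_mod_cast Nat.one_le_iff_ne_zero.2 hk)
  -- the five monomials against `log⁸ k`
  have m1 : (∑ p ∈ k.primeFactors, Real.log p ^ 2) ^ 4 ≤ Real.log k ^ 8 := by
    calc (∑ p ∈ k.primeFactors, Real.log p ^ 2) ^ 4 ≤ (Real.log k ^ 2) ^ 4 := pow_le_pow_left₀ h20 h2 4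
      _ = Real.log k ^ 8 := by ring
  have m1' : 0 ≤ (∑ p ∈ k.primeFactors, Real.log p ^ 2) ^ 4 := pow_nonneg h20 4
  have m2 : (∑ p ∈ k.primeFactors, Real.log p ^ 2) ^ 2 * (∑ p ∈ k.primeFactors, Real.log p ^ 4) ≤ Real.log k ^ 8 := by
    calc (∑ p ∈ k.primeFactors, Real.log p ^ 2) ^ 2 * (∑ p ∈ k.primeFactors, Real.log p ^ 4) ≤ (Real.log k ^ 2) ^ 2 * Real.log k ^ 4 :=
          mul_le_mul (pow_le_pow_left₀ h20 h2 2) h4 h40 (by positivity)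
      _ = Real.log k ^ 8 := by ring
  have m2' : 0 ≤ (∑ p ∈ k.primeFactors, Real.log p ^ 2) ^ 2 * (∑ p ∈ k.primeFactors, Real.log p ^ 4) := mul_nonneg (pow_nonneg h20 2) h40
  have m3 : (∑ p ∈ k.primeFactors, Real.log p ^ 2) * (∑ p ∈ k.primeFactors, Real.log p ^ 6) ≤ Real.log k ^ 8 := by
    calc (∑ p ∈ k.primeFactors, Real.log p ^ 2) * (∑ p ∈ k.primeFactors, Real.log p ^ 6) ≤ Real.log k ^ 2 * Real.log k ^ 6 :=
          mul_le_mul h2 h6 h60 (by positivity)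
      _ = Real.log k ^ 8 := by ring
  have m3' : 0 ≤ (∑ p ∈ k.primeFactors, Real.log p ^ 2) * (∑ p ∈ k.primeFactors, Real.log p ^ 6) := mul_nonneg h20 h60
  have m4 : (∑ p ∈ k.primeFactors, Real.log p ^ 4) ^ 2 ≤ Real.log k ^ 8 := by
    calc (∑ p ∈ k.primeFactors, Real.log p ^ 4) ^ 2 ≤ (Real.log k ^ 4) ^ 2 := pow_le_pow_left₀ h40 h4 2
      _ = Real.log k ^ 8 := by ring
  have m4' : 0 ≤ (∑ p ∈ k.primeFactors, Real.log p ^ 4) ^ 2 := pow_nonneg h40 2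
  rw [abs_le]
  constructor <;> nlinarith [m1, m1', m2, m2', m3, m3', m4, m4', h8, h80]

/-- `Σ_{k≤Y} (τ(k)/k)·|D₈(k)|·ℓ⁺(k)^m ≤ 1385·log^mY·(1+log Y)¹⁰` (`Y ≥ 1`). [folklore] -/
theorem sum_tau_div_decorEight_ellp_pow_le (m : ℕ) {Y : ℝ} (hY : 1 ≤ Y) :
    ∑ k ∈ Icc 1 ⌊Y⌋₊, (k.divisors.card : ℝ) / k *
        |105 * (∑ p ∈ k.primeFactors, Real.log p ^ 2) ^ 4 - 420 * (∑ p ∈ k.primeFactors, Real.log p ^ 2) ^ 2 * (∑ p ∈ k.primeFactors, Real.log p ^ 4) +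
          448 * (∑ p ∈ k.primeFactors, Real.log p ^ 2) * (∑ p ∈ k.primeFactors, Real.log p ^ 6) + 140 * (∑ p ∈ k.primeFactors, Real.log p ^ 4) ^ 2 -
          272 * ∑ p ∈ k.primeFactors, Real.log p ^ 8| * ellp Y k ^ m ≤
      1385 * Real.log Y ^ m * (1 + Real.log Y) ^ 10 := by
  have hY0 : 0 < Y := by linarith
  have hLY : 0 ≤ Real.log Y := Real.log_nonneg hY
  have h1 : ∀ k ∈ Icc 1 ⌊Y⌋₊, (k.divisors.card : ℝ) / k *
      |105 * (∑ p ∈ k.primeFactors, Real.log p ^ 2) ^ 4 - 420 * (∑ p ∈ k.primeFactors, Real.log p ^ 2) ^ 2 * (∑ p ∈ k.primeFactors, Real.log p ^ 4) +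
          448 * (∑ p ∈ k.primeFactors, Real.log p ^ 2) * (∑ p ∈ k.primeFactors, Real.log p ^ 6) + 140 * (∑ p ∈ k.primeFactors, Real.log p ^ 4) ^ 2 -
          272 * ∑ p ∈ k.primeFactors, Real.log p ^ 8| * ellp Y k ^ m ≤
      (k.divisors.card : ℝ) / k * (1385 * Real.log Y ^ 8 * Real.log Y ^ m) := by
    intro k hk
    have hk1 := (Finset.mem_Icc.1 hk).1
    have hkY : (k : ℝ) ≤ Y := le_trans (by exact_mod_cast (Finset.mem_Icc.1 hk).2) (Nat.floor_le hY0.le)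
    have hk0 : k ≠ 0 := by omega
    have hlogk : Real.log k ≤ Real.log Y := Real.log_le_log (by exact_mod_cast hk1) hkY
    have hlogk0 : 0 ≤ Real.log k := Real.log_nonneg (by exact_mod_cast hk1)
    have hD : |105 * (∑ p ∈ k.primeFactors, Real.log p ^ 2) ^ 4 - 420 * (∑ p ∈ k.primeFactors, Real.log p ^ 2) ^ 2 * (∑ p ∈ k.primeFactors, Real.log p ^ 4) +
          448 * (∑ p ∈ k.primeFactors, Real.log p ^ 2) * (∑ p ∈ k.primeFactors, Real.log p ^ 6) + 140 * (∑ p ∈ k.primeFactors, Real.log p ^ 4) ^ 2 -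
          272 * ∑ p ∈ k.primeFactors, Real.log p ^ 8| ≤
        1385 * Real.log Y ^ 8 :=
      (abs_decorEight_le hk0).trans (by gcongr)
    have hl : ellp Y k ^ m ≤ Real.log Y ^ m := pow_le_pow_left₀ (ellp_nonneg Y k) (ellp_le_log hY hk1) m
    rw [mul_assoc]
    refine mul_le_mul_of_nonneg_left ?_ (by positivity)
    exact mul_le_mul hD hl (pow_nonneg (ellp_nonneg Y k) m) (by positivity)
  refine (Finset.sum_le_sum h1).trans ?_
  rw [← Finset.sum_mul]
  have h2 : ∑ k ∈ Icc 1 ⌊Y⌋₊, (k.divisors.card : ℝ) / k ≤ (1 + Real.log ⌊Y⌋₊) ^ 2 := by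
    rw [Icc_one_eq_Ioc_zero]
    exact Literature.NumberTheory.Sieve.Vaughan.sum_card_divisors_div_le ⌊Y⌋₊
  have h3 : (1 + Real.log ⌊Y⌋₊) ^ 2 ≤ (1 + Real.log Y) ^ 2 := by
    have hf1 : (1 : ℝ) ≤ ⌊Y⌋₊ := by exact_mod_cast Nat.le_floor (by simpa using hY)
    have : Real.log (⌊Y⌋₊ : ℝ) ≤ Real.log Y := Real.log_le_log (by linarith) (Nat.floor_le hY0.le)
    have : 0 ≤ Real.log (⌊Y⌋₊ : ℝ) := Real.log_nonneg hf1
    nlinarith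
  have h4 : Real.log Y ^ 8 ≤ (1 + Real.log Y) ^ 8 := pow_le_pow_left₀ hLY (by linarith) 8
  calc (∑ k ∈ Icc 1 ⌊Y⌋₊, (k.divisors.card : ℝ) / k) * (1385 * Real.log Y ^ 8 * Real.log Y ^ m)
      ≤ (1 + Real.log Y) ^ 2 * (1385 * (1 + Real.log Y) ^ 8 * Real.log Y ^ m) := by
        refine mul_le_mul (h2.trans h3) ?_ (by positivity) (by positivity)
        exact mul_le_mul_of_nonneg_right (by linarith) (pow_nonneg hLY m)
    _ = 1385 * Real.log Y ^ m * (1 + Real.log Y) ^ 10 := by ring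

/-- Partial sums of the `D₈`-decorated column: `|Σ_{k≤e} a_n(k)D₈(k)| ≤ 1385(1+log Y)¹⁰` for `e ≤ ⌊Y⌋`. [folklore] -/
theorem abs_sum_copTauW_decorEight_le (n : ℕ) {Y : ℝ} (hY : 1 ≤ Y) {e : ℕ} (he : e ≤ ⌊Y⌋₊) :
    |∑ k ∈ Icc 1 e, copTauW n k *
        (105 * (∑ p ∈ k.primeFactors, Real.log p ^ 2) ^ 4 - 420 * (∑ p ∈ k.primeFactors, Real.log p ^ 2) ^ 2 * (∑ p ∈ k.primeFactors, Real.log p ^ 4) +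
          448 * (∑ p ∈ k.primeFactors, Real.log p ^ 2) * (∑ p ∈ k.primeFactors, Real.log p ^ 6) + 140 * (∑ p ∈ k.primeFactors, Real.log p ^ 4) ^ 2 -
          272 * ∑ p ∈ k.primeFactors, Real.log p ^ 8)| ≤
      1385 * (1 + Real.log Y) ^ 10 := by
  have h := sum_tau_div_decorEight_ellp_pow_le 0 hY
  simp only [pow_zero, mul_one] at h
  calc _ ≤ ∑ k ∈ Icc 1 e, |copTauW n k *
          (105 * (∑ p ∈ k.primeFactors, Real.log p ^ 2) ^ 4 - 420 * (∑ p ∈ k.primeFactors, Real.log p ^ 2) ^ 2 * (∑ p ∈ k.primeFactors, Real.log p ^ 4) +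
            448 * (∑ p ∈ k.primeFactors, Real.log p ^ 2) * (∑ p ∈ k.primeFactors, Real.log p ^ 6) + 140 * (∑ p ∈ k.primeFactors, Real.log p ^ 4) ^ 2 -
            272 * ∑ p ∈ k.primeFactors, Real.log p ^ 8)| :=
        Finset.abs_sum_le_sum_abs _ _
    _ ≤ ∑ k ∈ Icc 1 ⌊Y⌋₊, |copTauW n k *
          (105 * (∑ p ∈ k.primeFactors, Real.log p ^ 2) ^ 4 - 420 * (∑ p ∈ k.primeFactors, Real.log p ^ 2) ^ 2 * (∑ p ∈ k.primeFactors, Real.log p ^ 4) +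
            448 * (∑ p ∈ k.primeFactors, Real.log p ^ 2) * (∑ p ∈ k.primeFactors, Real.log p ^ 6) + 140 * (∑ p ∈ k.primeFactors, Real.log p ^ 4) ^ 2 -
            272 * ∑ p ∈ k.primeFactors, Real.log p ^ 8)| :=
        Finset.sum_le_sum_of_subset_of_nonneg (Finset.Icc_subset_Icc_right he) fun _ _ _ ↦ abs_nonneg _
    _ ≤ ∑ k ∈ Icc 1 ⌊Y⌋₊, (k.divisors.card : ℝ) / k *
          |105 * (∑ p ∈ k.primeFactors, Real.log p ^ 2) ^ 4 - 420 * (∑ p ∈ k.primeFactors, Real.log p ^ 2) ^ 2 * (∑ p ∈ k.primeFactors, Real.log p ^ 4) +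
            448 * (∑ p ∈ k.primeFactors, Real.log p ^ 2) * (∑ p ∈ k.primeFactors, Real.log p ^ 6) + 140 * (∑ p ∈ k.primeFactors, Real.log p ^ 4) ^ 2 -
            272 * ∑ p ∈ k.primeFactors, Real.log p ^ 8| := by
        refine Finset.sum_le_sum fun k _ ↦ ?_
        rw [abs_mul]
        exact mul_le_mul_of_nonneg_right (abs_copTauW_le n k) (abs_nonneg _)
    _ ≤ 1385 * (1 + Real.log Y) ^ 10 := by simpa using h

/-- `Σ_{k≤Y} |a_n(k)D₈(k)|·ℓ⁺(k)^m ≤ 1385·log^mY·(1+log Y)¹⁰`. [folklore] -/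
theorem sum_abs_copTauW_decorEight_ellp_pow_le (n m : ℕ) {Y : ℝ} (hY : 1 ≤ Y) :
    ∑ k ∈ Icc 1 ⌊Y⌋₊, |copTauW n k *
        (105 * (∑ p ∈ k.primeFactors, Real.log p ^ 2) ^ 4 - 420 * (∑ p ∈ k.primeFactors, Real.log p ^ 2) ^ 2 * (∑ p ∈ k.primeFactors, Real.log p ^ 4) +
          448 * (∑ p ∈ k.primeFactors, Real.log p ^ 2) * (∑ p ∈ k.primeFactors, Real.log p ^ 6) + 140 * (∑ p ∈ k.primeFactors, Real.log p ^ 4) ^ 2 -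
          272 * ∑ p ∈ k.primeFactors, Real.log p ^ 8)| * ellp Y k ^ m ≤
      1385 * Real.log Y ^ m * (1 + Real.log Y) ^ 10 := by
  refine le_trans (Finset.sum_le_sum fun k _ ↦ ?_) (sum_tau_div_decorEight_ellp_pow_le m hY)
  rw [abs_mul]
  exact mul_le_mul_of_nonneg_right (mul_le_mul_of_nonneg_right (abs_copTauW_le n k) (abs_nonneg _))
    (pow_nonneg (ellp_nonneg Y k) m)

end Summit.Parity.GeneralizedHardyLittlewood.Theorems.MomentsBeyondDiagonal.DiagCorner

end
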